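import Mathlib

/-!
# T5Semilinear — Galois transport of eigenlines after extension of scalars (N1 §ID-2(c))

Prose step (route/T5-ID-p2.md v7.1, ID-2(c), «right inclusion»): `Aut(ℂ)` acts on
`H¹_B(A_K ⊗_{τ₁} ℂ, ℂ) = H¹_B(·, ℚ) ⊗_ℚ ℂ` through the second factor; this action commutes with
every pull-back along a morphism of ℂ-varieties (pull-back is defined on ℚ-cohomology), in
particular with the endomorphisms `i_{μ}(x)^*` (`x ∈ M̃_μ`), with `φ^*`, `alb^*` and the Hecke
action; therefore `g_θ(α_{θ₀})` is again an eigenvector, with eigenvalue `g_θ(θ₀(x)) = θ(x)`: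
`ℓ_θ = g_θ(ℓ_{θ₀})`.

Formalised here over an arbitrary commutative ring `R` (ℚ), a commutative `R`-algebra `A` (ℂ), an
`R`-algebra automorphism `g : A ≃ₐ[R] A` (an element of `Aut(ℂ)`, automatically ℚ-linear) and an
`R`-module `M` (the rational cohomology): `galAct g := g ⊗ id` on `A ⊗[R] M`,
* it commutes with every base-changed `R`-linear map `T.baseChange A` («commutes with every
  pull-back», `galAct_baseChange`);
* it is `g`-semilinear for the `A`-action (`galAct_smul`);
* it maps the `μ`-eigenspace of `T.baseChange A` onto the `g μ`-eigenspace
  (`mem_eigenspace_galAct_iff`, `map_eigenspace_eq`), and likewise the joint eigenspace of a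
  family of commuting operators `(T x)_x` with eigen-character `θ₀` onto the joint eigenspace with
  eigen-character `g ∘ θ₀` (`mem_iInf_eigenspace_galAct_iff`) — this is «`ℓ_θ = g_θ(ℓ_{θ₀})`».
-/

namespace Summit.Ventures.HodgeRepro2.T5Semilinear

open TensorProduct

variable {R A M : Type*} [CommRing R] [CommRing A] [Algebra R A] [AddCommGroup M] [Module R M]

/-- The action of an `R`-algebra automorphism `g` of `A` on `A ⊗[R] M` through the first factor
(«`Aut(ℂ)` acting on the coefficients of `H¹(·, ℚ) ⊗ ℂ`»). -/
noncomputable def galAct (g : A ≃ₐ[R] A) : A ⊗[R] M ≃ₗ[R] A ⊗[R] M :=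
  TensorProduct.congr g.toLinearEquiv (LinearEquiv.refl R M)

/-- `galAct g (a ⊗ m) = g a ⊗ m`. -/
@[simp]
theorem galAct_tmul (g : A ≃ₐ[R] A) (a : A) (m : M) :
    galAct g (a ⊗ₜ[R] m) = g a ⊗ₜ[R] m := by
  simp [galAct]

/-- The inverse of `galAct g` is `galAct g.symm`. -/
theorem galAct_symm_galAct (g : A ≃ₐ[R] A) (v : A ⊗[R] M) :
    galAct g.symm (galAct g v) = v := by
  induction v using TensorProduct.induction_on with
  | zero => simp
  | tmul a m => simp
  | add x y hx hy => simp [map_add, hx, hy]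

/-- «The action commutes with every pull-back»: for every `R`-linear `T : M → M` (an endomorphism
defined on rational cohomology), `galAct g` commutes with its base change `T.baseChange A`. -/
theorem galAct_baseChange (g : A ≃ₐ[R] A) (T : M →ₗ[R] M) (v : A ⊗[R] M) :
    galAct g (T.baseChange A v) = T.baseChange A (galAct g v) := by
  induction v using TensorProduct.induction_on with
  | zero => simp
  | tmul a m => simp [LinearMap.baseChange_tmul]
  | add x y hx hy => simp [map_add, hx, hy]

/-- Semilinearity: `galAct g (c • v) = g c • galAct g v` for the `A`-module structure of
`A ⊗[R] M` (the action on the coefficients is `g`-semilinear, not `A`-linear). -/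
theorem galAct_smul (g : A ≃ₐ[R] A) (c : A) (v : A ⊗[R] M) :
    galAct g (c • v) = g c • galAct g v := by
  induction v using TensorProduct.induction_on with
  | zero => simp
  | tmul a m => simp [TensorProduct.smul_tmul', smul_eq_mul, map_mul]
  | add x y hx hy => simp [smul_add, map_add, hx, hy]

/-- An eigenvector of `T.baseChange A` with eigenvalue `μ` is mapped by `galAct g` to an
eigenvector with eigenvalue `g μ`: `i(x)^* g_θ(α) = g_θ(θ₀(x) α) = θ(x) g_θ(α)`. -/
theorem mem_eigenspace_galAct (g : A ≃ₐ[R] A) (T : M →ₗ[R] M) (μ : A) (v : A ⊗[R] M)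
    (hv : v ∈ Module.End.eigenspace (T.baseChange A) μ) :
    galAct g v ∈ Module.End.eigenspace (T.baseChange A) (g μ) := by
  rw [Module.End.mem_eigenspace_iff] at hv ⊢
  rw [← galAct_baseChange, hv, galAct_smul]

/-- The eigenspace statement is an equivalence (apply the previous theorem to `g.symm`). -/
theorem mem_eigenspace_galAct_iff (g : A ≃ₐ[R] A) (T : M →ₗ[R] M) (μ : A) (v : A ⊗[R] M) :
    galAct g v ∈ Module.End.eigenspace (T.baseChange A) (g μ) ↔
      v ∈ Module.End.eigenspace (T.baseChange A) μ := by
  constructor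
  · intro h
    have h' := mem_eigenspace_galAct g.symm T (g μ) (galAct g v) h
    rwa [galAct_symm_galAct, AlgEquiv.symm_apply_apply] at h'
  · exact mem_eigenspace_galAct g T μ v

/-- `galAct g` maps the `μ`-eigenspace of `T.baseChange A` ONTO the `g μ`-eigenspace (as
`R`-submodules): `ℓ_θ = g_θ(ℓ_{θ₀})` for a single operator. -/
theorem map_eigenspace_eq (g : A ≃ₐ[R] A) (T : M →ₗ[R] M) (μ : A) :
    Submodule.map (galAct (M := M) g).toLinearMap
        ((Module.End.eigenspace (T.baseChange A) μ).restrictScalars R) =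
      (Module.End.eigenspace (T.baseChange A) (g μ)).restrictScalars R := by
  ext x
  constructor
  · rintro ⟨v, hv, rfl⟩
    exact mem_eigenspace_galAct g T μ v hv
  · intro hx
    refine ⟨galAct g.symm x, ?_, ?_⟩
    · have h := mem_eigenspace_galAct g.symm T (g μ) x hx
      rwa [AlgEquiv.symm_apply_apply] at h
    · have := galAct_symm_galAct g.symm x
      rwa [AlgEquiv.symm_symm] at this

/-- Joint eigenspaces: for a family of operators `T x` (the endomorphisms `i(x)^*`, `x ∈ M̃_μ`)
with eigen-character `θ₀ : ι → A`, `galAct g` maps the joint `θ₀`-eigenspace to the joint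
`g ∘ θ₀`-eigenspace, and conversely: `v ∈ ℓ_{θ₀} ⟺ g_θ(v) ∈ ℓ_θ` with `θ = g ∘ θ₀`. -/
theorem mem_iInf_eigenspace_galAct_iff {ι : Type*} (g : A ≃ₐ[R] A) (T : ι → M →ₗ[R] M)
    (θ₀ : ι → A) (v : A ⊗[R] M) :
    galAct g v ∈ ⨅ x, Module.End.eigenspace ((T x).baseChange A) (g (θ₀ x)) ↔
      v ∈ ⨅ x, Module.End.eigenspace ((T x).baseChange A) (θ₀ x) := by
  simp only [Submodule.mem_iInf]
  exact forall_congr' fun x => mem_eigenspace_galAct_iff g (T x) (θ₀ x) v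

/-- Injectivity of the Galois action on `A ⊗[R] M` (a linear equivalence). -/
theorem galAct_injective (g : A ≃ₐ[R] A) : Function.Injective (galAct (M := M) g) :=
  (galAct g).injective

end Summit.Ventures.HodgeRepro2.T5Semilinear
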